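import Summits.CriticalPhenomena.CardyFormulaZ2.Theorems.CardyComplexConeParafermionToSLESixFamiliesDiamondTouchLowerBox
import Summits.CriticalPhenomena.CardyFormulaZ2.Theorems.CardyComplexConeParafermionToSLESixFamiliesDiamondClosedPrecompactnessTouchMassSum
import HarnessLib

/-!
# Touch sites in the middle half of a free side and the touch mass they carry
# (line `potential-darboux-picard-diamond`, S3 (c) `freeTouchLower_of_diagArmLower`, part 8)

Crux `ParafermionToSLESixFamilies` (stmt-CriticalPhenomena-11389), line `potential-darboux-picard-diamond`, conditional
helper `freeTouchLower_of_diagArmLower` of S3. In the chart of a free side (`…DiamondTraceFreeCore`: frame `e`, across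
coordinate `(δ/√2)·layerFn j + X₀`, along coordinate `(δ/√2)·layerFn (j+1) + Y₀`, last inside layer `n`, the discrete arcs
of the window read off `eventually_arcs_near_freeSegment`) and for an oriented free segment `[p, q]` of the side line with
ordinates `Yp < Yq`:

* `touchSite_of_window` — every site of the touch row `layerFn j = n − 2` whose ordinate lies in the middle half
  `[Yp + L/4, Yq − L/4]` (`L = Yq − Yp = ‖q − p‖`) is a touch site within `3δ` of `[p, q]` with `proj ∈ [L/4, 3L/4]`
  (`touchRow_of_chart`, `near_segment_of_chart`, `proj_eq_im_sub`);
* `touchMass_ge_of_row` — for the explicit row `site[j, n − 2, B + 2i]`, `i < N`, of such sites (local notation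
  `site[j, A, B]` for the lattice site with chart coordinates `(A, B)`), a common lower bound `θ` of their touch
  probabilities gives `δ^{2/3} · (N · θ) ≤ touchMass E δ p q (‖q − p‖/4) (3‖q − p‖/4)` (`touchMass_ge_card_mul`).
-/

noncomputable section

namespace Summit.CriticalPhenomena.CardyFormulaZ2.Cruxes.ParafermionToSLESixFamilies.PotentialDarbouxPicardDiamond

open scoped Topology BigOperators
open Filter Set Metric Complex MeasureTheory
open Literature.Probability Literature.Probability.LatticeModels Literature.Probability.Percolation
open Literature.Probability.LatticeModels.DiscreteDobrushin
open Literature.Probability.RandomPlanarGeometry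
open Summit.CriticalPhenomena.CardyFormulaZ2.Cruxes.ParafermionToSLESixFamilies.IicTraceFluxPairing

/-- The lattice site with chart coordinates `(A, B)` of orientation `j` (meaningful for `A ≡ B (mod 2)`). -/
local notation3 "site[" j ", " A ", " B "]" => (((A : ℤ) - B) / 2) • cornerUnit (j + 1) + ((A + B) / 2) • cornerUnit (j + 2)

section Window

variable {c e : ℂ} (he : ‖e‖ = 1) {α β δ : ℝ} (hδ : 0 < δ) (hα : 4 * δ ≤ α) {E : DiscreteDobrushin}
  (hΩ : E.Ω = {z : ℂ | |((z - c) * e).re| < α ∧ |((z - c) * e).im| < β}) (hEδ : E.δ = δ)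
  (hgood : ∀ x : Site 2, meshPoint δ x ∈ E.Ω → x ∈ meshDomain E.Ω δ)
  {j : Fin 4} {X₀ Y₀ : ℝ} (hX : ∀ x : Site 2, ((meshPoint δ x - c) * e).re = Real.sqrt 2 / 2 * δ * layerFn j x + X₀)
  (hY : ∀ x : Site 2, ((meshPoint δ x - c) * e).im = Real.sqrt 2 / 2 * δ * layerFn (j + 1) x + Y₀)
  {n : ℤ} (hn : Real.sqrt 2 / 2 * δ * n + X₀ < α) (hn' : α ≤ Real.sqrt 2 / 2 * δ * (n + 1) + X₀)
  {p q : ℂ} {Yp Yq : ℝ} (hpX : ((p - c) * e).re = α) (hqX : ((q - c) * e).re = α) (hpY : ((p - c) * e).im = Yp)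
  (hqY : ((q - c) * e).im = Yq) (hYp : -β ≤ Yp) (hYq : Yq ≤ β) (hL : 40 * δ ≤ Yq - Yp)
  (hArc : ∀ x : Site 2, n - 4 ≤ layerFn j x → layerFn j x ≤ n → Yp + (Yq - Yp) / 8 ≤ ((meshPoint δ x - c) * e).im →
    ((meshPoint δ x - c) * e).im ≤ Yq - (Yq - Yp) / 8 → x ∉ E.zdArcA ∧ (x ∈ E.zdBoundary → x ∈ E.zdArcB))

include he hδ hα hΩ hEδ hgood hX hY hn hn' hpX hqX hpY hqY hYp hYq hL hArc in
/-- **A touch-row site of the middle half of the free side is a touch site of the window of `touchMass`.** -/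
theorem touchSite_of_window {x : Site 2} (hA : layerFn j x = n - 2) (h1 : Yp + (Yq - Yp) / 4 ≤ ((meshPoint δ x - c) * e).im)
    (h2 : ((meshPoint δ x - c) * e).im ≤ Yq - (Yq - Yp) / 4) :
    x ∈ touchSites E ∧ infDist (meshPoint δ x) (segment ℝ p q) ≤ 3 * δ ∧ ‖q - p‖ / 4 ≤ proj p q (meshPoint δ x) ∧
      proj p q (meshPoint δ x) ≤ 3 * ‖q - p‖ / 4 := by
  have hpq : Yp < Yq := by linarith
  obtain ⟨hxA, hxB, hB1, -, hf0, -, -⟩ := touchRow_of_chart he hδ hα hΩ hEδ hgood hX hY hn hn' (Yl := Yp + (Yq - Yp) / 8)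
    (Yr := Yq - (Yq - Yp) / 8) (by linarith) (by linarith) hArc hA (by linarith) (by linarith)
  obtain ⟨hd, -, -⟩ := near_segment_of_chart he hδ hpX hqX hpY hqY hpq hX hn hn' le_rfl x 2 (by push_cast; omega) (by omega)
    (by linarith) (by linarith)
  have hnorm : ‖q - p‖ = Yq - Yp := norm_q_sub_p he hpX hqX hpY hqY hpq.le
  have hproj : proj p q (meshPoint δ x) = ((meshPoint δ x - c) * e).im - Yp := proj_eq_im_sub he hpX hqX hpY hqY hpq _
  refine ⟨⟨hxA, hxB, faceAt x j, hf0, isCorner_faceAt x j, x + cornerUnit (j + 1), ?_, hB1⟩, ?_, ?_, ?_⟩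
  · exact (isCorner_add_faceAt_iff x (j + 1) j).2 (Or.inr (fin4_add_one_add_three j).symm)
  · push_cast at hd; linarith
  · rw [hnorm, hproj]; linarith
  · rw [hnorm, hproj]; linarith

include he hδ hα hΩ hEδ hgood hX hY hn hn' hpX hqX hpY hqY hYp hYq hL hArc in
/-- **The touch mass of the middle half from a row of touch sites with a common lower bound.** For `B ≡ n (mod 2)` and
`N` sites `site[j, n − 2, B + 2i]`, `i < N`, of the touch row with ordinates in the middle half of `[p, q]`, each of
touch probability `≥ θ`: `δ^{2/3} · (N · θ) ≤ touchMass E δ p q (‖q − p‖/4) (3‖q − p‖/4)`. -/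
theorem touchMass_ge_of_row (hfin : (touchSites E).Finite) {B : ℤ} (hpar : 2 ∣ n - 2 - B) {N : ℕ}
    (hB : Yp + (Yq - Yp) / 4 ≤ Real.sqrt 2 / 2 * δ * B + Y₀)
    (hN : ∀ i : ℕ, i < N → Real.sqrt 2 / 2 * δ * (B + 2 * i) + Y₀ ≤ Yq - (Yq - Yp) / 4) {θ : ℝ}
    (hθ : ∀ i : ℕ, i < N → θ ≤ touchProb E site[j, n - 2, B + 2 * i]) :
    δ ^ ((2:ℝ) / 3) * (N * θ) ≤ touchMass E δ p q (‖q - p‖ / 4) (3 * ‖q - p‖ / 4) := by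
  classical
  have hchart : ∀ i : ℕ, layerFn j site[j, n - 2, B + 2 * i] = n - 2 ∧ layerFn (j + 1) site[j, n - 2, B + 2 * i] = B + 2 * i :=
    fun i => layerFn_siteOf j (A := n - 2) (B := B + 2 * i) (by obtain ⟨t, ht⟩ := hpar; exact ⟨t - i, by omega⟩)
  set f : ℕ → Site 2 := fun i => site[j, n - 2, B + 2 * i] with hf
  have hinj : Set.InjOn f ↑(Finset.range N) := by
    intro a _ b _ h
    have := congrArg (layerFn (j + 1)) h
    simp only [hf, (hchart a).2, (hchart b).2] at this
    exact_mod_cast (show (a : ℤ) = b by omega)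
  have hcard : ((Finset.range N).image f).card = N := by rw [Finset.card_image_of_injOn hinj, Finset.card_range]
  have key := touchMass_ge_card_mul E δ p q (‖q - p‖ / 4) (3 * ‖q - p‖ / 4) θ ((Finset.range N).image f) hδ.le hfin
    (fun x hx => ?_) (fun x hx => ?_)
  · rwa [hcard] at key
  · obtain ⟨i, hi, rfl⟩ := Finset.mem_image.1 hx
    have hi' := Finset.mem_range.1 hi
    have him : ((meshPoint δ (f i) - c) * e).im = Real.sqrt 2 / 2 * δ * (B + 2 * i) + Y₀ := by
      rw [hY, (hchart i).2]; push_cast; ring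
    have hpos : 0 ≤ Real.sqrt 2 / 2 * δ * (2 * i) := by positivity
    exact touchSite_of_window he hδ hα hΩ hEδ hgood hX hY hn hn' hpX hqX hpY hqY hYp hYq hL hArc (hchart i).1
      (by rw [him]; nlinarith) (by rw [him]; exact hN i hi')
  · obtain ⟨i, hi, rfl⟩ := Finset.mem_image.1 hx
    exact hθ i (Finset.mem_range.1 hi)

end Window

/-- **Registered form of `touchSite_of_window` (helper of `freeTouchLower_of_diagArmLower`), notation-free.** -/
theorem touchLower_touchSite_of_window : ∀ (c e : ℂ), ‖e‖ = 1 → ∀ (α β δ : ℝ), 0 < δ → 4 * δ ≤ α → ∀ (E : DiscreteDobrushin), E.Ω = {z : ℂ | |((z - c) * e).re| < α ∧ |((z - c) * e).im| < β} → E.δ = δ → (∀ x : Site 2, meshPoint δ x ∈ E.Ω → x ∈ meshDomain E.Ω δ) → ∀ (j : Fin 4) (X₀ Y₀ : ℝ), (∀ x : Site 2, ((meshPoint δ x - c) * e).re = Real.sqrt 2 / 2 * δ * layerFn j x + X₀) → (∀ x : Site 2, ((meshPoint δ x - c) * e).im = Real.sqrt 2 / 2 * δ * layerFn (j + 1) x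 + Y₀) → ∀ (n : ℤ), Real.sqrt 2 / 2 * δ * n + X₀ < α → α ≤ Real.sqrt 2 / 2 * δ * (n + 1) + X₀ → ∀ (p q : ℂ) (Yp Yq : ℝ), ((p - c) * e).re = α → ((q - c) * e).re = α → ((p - c) * e).im = Yp → ((q - c) * e).im = Yq → -β ≤ Yp → Yq ≤ β → 40 * δ ≤ Yq - Yp → (∀ x : Site 2, n - 4 ≤ layerFn j x → layerFn j x ≤ n → Yp + (Yq - Yp) / 8 ≤ ((meshPoint δ x - c) * e).im → ((meshPoint δ x - c) * e).im ≤ Yq - (Yq - Yp) / 8 → x ∉ E.zdArcA ∧ (x ∈ E.zdBoundary → x ∈ E.zdArcB)) → ∀ x : Site 2, layerFn j x = n - 2 → Yp + (Yq - Yp) / 4 ≤ ((meshPoint δ x - c) * e).im → ((meshPoint δ x - c) * e).im ≤ Yq - (Yq - Yp) / 4 → x ∈ touchSites E ∧ infDist (meshPoint δ x) (segment ℝ p q) ≤ 3 * δ ∧ ‖q - p‖ / 4 ≤ proj p q (meshPoint δ x) ∧ proj p q (meshPoint δ x) ≤ 3 * ‖q - p‖ / 4 :=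
  fun _ _ he _ _ _ hδ hα _ hΩ hEδ hgood _ _ _ hX hY _ hn hn' _ _ _ _ hpX hqX hpY hqY hYp hYq hL hArc _ hA h1 h2 =>
    touchSite_of_window he hδ hα hΩ hEδ hgood hX hY hn hn' hpX hqX hpY hqY hYp hYq hL hArc hA h1 h2

end Summit.CriticalPhenomena.CardyFormulaZ2.Cruxes.ParafermionToSLESixFamilies.PotentialDarbouxPicardDiamond

end
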